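import Literature.Computability.Complexity.GateEliminationCase5Chain2
import Literature.Computability.Complexity.GateEliminationCase5Alt

/-!
# Gate elimination: Case 5.2 of Li–Yang's proof of Theorem 4.1

"When `D` feeds both `B` and `C`, we perform constant substitution to `x` to trivialize `G`, and
eliminate `G`, `D` and `B` in order. By normalization lemma, the only node that may become or
feed a troubled gate is the other input `I` of `D`. Furthermore, if `I` is a gate, then … it
cannot become troubled. Hence to introduce a troubled gate, `I` must be a variable `u` and `B`
must feed another ∧-type gate `E` … After the normalization, `u` should be a `2`-variable feeding
exactly `C` and `E`, hence `B` should be a `1`-gate originally. Instead of substituting to `x`, we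
substitute appropriate constant to `z` and `y` so that both `E` and `G` are trivialized, then
eliminate `B` by Rule 1. These two substitutions kill three influential inputs `x`, `y` and `z`,
hence `Δμ ≥ 3α_I/2 ≥ δ` per substitution." (ECCC TR21-023, §4.1, Case 5.2.)

PROVED here (`LiYang2022_case5_2_holds`) by a complete analysis of the chain of
`GateEliminationCase5Chain.lean` under the standing assumptions: (1) if some ∧-type gate `E`
reads `B` and a variable `z` and `B` is a `1`-gate, the two substitutions `y, z`
(`stepGoal_two_consts`); (2) otherwise, if the elimination of `B` replaces its out-wires by a
constant, the main strategy with the reader of `B` as a fourth elimination (`case5_main4`; the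
only possible new troubled gate is a third reader of `D` — a configuration the printed text
passes over); (3) otherwise the main strategy introduces no troubled gate (`case5_main'`).

## References

* J. Li, T. Yang, *3.1n − o(n) circuit lower bounds for explicit functions*, STOC 2022;
  ECCC TR21-023, §4.1 (Case 5.2), Lemma 3.11.
-/

namespace Literature.Computability.Complexity

open Finset

namespace Semicircuit

variable {n : ℕ} {C : Semicircuit n} {f : (Fin n → ZMod 2) → Bool} {R : RdqSource n} {d : ℕ}
  {αφ αI αQ : ℝ} {G : Fin C.m} {x y : Fin n} {B C' D : Fin C.m} {aX aB aC aD : Fin 2}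

/-- Three distinct readers give out-degree `≥ 3`. [folklore] -/
theorem three_le_fanout {D : Semicircuit n} {v : Node n D.m} {k₁ k₂ k₃ : Fin D.m} {a₁ a₂ a₃ : Fin 2}
    (h₁ : D.arg k₁ a₁ = v) (h₂ : D.arg k₂ a₂ = v) (h₃ : D.arg k₃ a₃ = v) (h12 : k₁ ≠ k₂) (h13 : k₁ ≠ k₃) (h23 : k₂ ≠ k₃) :
    3 ≤ D.fanout v := by
  classical
  have hsub : ({k₁, k₂, k₃} : Finset (Fin D.m)) ⊆ univ := subset_univ _
  have hnot : k₁ ∉ ({k₂, k₃} : Finset (Fin D.m)) := by rw [mem_insert, mem_singleton, not_or]; exact ⟨h12, h13⟩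
  have := sum_le_sum_of_subset_of_nonneg hsub (f := fun k => (univ.filter fun a : Fin 2 => D.arg k a = v).card)
    (fun _ _ _ => Nat.zero_le _)
  rw [sum_insert hnot, sum_pair h23] at this
  have e₁ : 1 ≤ (univ.filter fun a : Fin 2 => D.arg k₁ a = v).card := card_pos.mpr ⟨a₁, mem_filter.mpr ⟨mem_univ _, h₁⟩⟩
  have e₂ : 1 ≤ (univ.filter fun a : Fin 2 => D.arg k₂ a = v).card := card_pos.mpr ⟨a₂, mem_filter.mpr ⟨mem_univ _, h₂⟩⟩
  have e₃ : 1 ≤ (univ.filter fun a : Fin 2 => D.arg k₃ a = v).card := card_pos.mpr ⟨a₃, mem_filter.mpr ⟨mem_univ _, h₃⟩⟩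
  unfold fanout
  omega

/-- Two distinct readers give out-degree `≥ 2`. [folklore] -/
theorem two_le_fanout {D : Semicircuit n} {v : Node n D.m} {k₁ k₂ : Fin D.m} {a₁ a₂ : Fin 2}
    (h₁ : D.arg k₁ a₁ = v) (h₂ : D.arg k₂ a₂ = v) (h12 : k₁ ≠ k₂) : 2 ≤ D.fanout v := by
  classical
  have hsub : ({k₁, k₂} : Finset (Fin D.m)) ⊆ univ := subset_univ _
  have := sum_le_sum_of_subset_of_nonneg hsub (f := fun k => (univ.filter fun a : Fin 2 => D.arg k a = v).card)
    (fun _ _ _ => Nat.zero_le _)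
  rw [sum_pair h12] at this
  have e₁ : 1 ≤ (univ.filter fun a : Fin 2 => D.arg k₁ a = v).card := card_pos.mpr ⟨a₁, mem_filter.mpr ⟨mem_univ _, h₁⟩⟩
  have e₂ : 1 ≤ (univ.filter fun a : Fin 2 => D.arg k₂ a = v).card := card_pos.mpr ⟨a₂, mem_filter.mpr ⟨mem_univ _, h₂⟩⟩
  unfold fanout
  omega

/-- One reader gives out-degree `≥ 1`: deprecated alias of `one_le_fanout_of_arg_eq`
(`GateEliminationRule4Sharp.lean`), kept only for importers not yet migrated — use that name. [folklore] -/
@[deprecated one_le_fanout_of_arg_eq (since := "2026-08-15")]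
theorem one_le_fanout {D : Semicircuit n} {v : Node n D.m} {k₁ : Fin D.m} {a₁ : Fin 2} (h₁ : D.arg k₁ a₁ = v) :
    1 ≤ D.fanout v :=
  one_le_fanout_of_arg_eq h₁

/-- A troubled gate reading `x_v` has `fanout v = 2`. [folklore] -/
theorem Troubled.fanout_eq_two {D : Semicircuit n} {k : Fin D.m} (hT : D.Troubled k) {a : Fin 2} {v : Fin n}
    (h : D.arg k a = .var v) : D.fanout (.var v) = 2 := by
  obtain ⟨-, -, -, -, -, h2, -⟩ := hT.exists_wires_of_reads ⟨a, h⟩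
  exact h2

/-- The wires of a troubled gate are variables. [folklore] -/
theorem Troubled.arg_isVar {D : Semicircuit n} {k : Fin D.m} (hT : D.Troubled k) (a : Fin 2) : ∃ v, D.arg k a = .var v := by
  obtain ⟨-, -, x, y, -, hr, -⟩ := hT
  have : D.arg k a ∈ Set.range (D.arg k) := ⟨a, rfl⟩
  rw [hr] at this
  rcases this with h | h
  · exact ⟨x, h⟩
  · exact ⟨y, h⟩

/-- The two wires of a troubled gate differ. [folklore] -/
theorem Troubled.arg_ne {D : Semicircuit n} {k : Fin D.m} (hT : D.Troubled k) (a : Fin 2) : D.arg k a ≠ D.arg k a.rev := by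
  obtain ⟨v, hv⟩ := hT.arg_isVar a
  obtain ⟨p, w, hwv, hp, hprev, -⟩ := hT.exists_wires_of_reads ⟨a, hv⟩
  intro h
  rcases fin2_eq_or_eq_rev a p with e | e
  · rw [e] at hprev; rw [← h, hv] at hprev; cases hprev; exact hwv rfl
  · rw [e, Fin.rev_rev] at hprev; rw [e] at hp
    rw [hv] at hprev; cases hprev; exact hwv rfl

/-- A gate is troubled afterwards iff before, when it does not read `k₀`, the out-degrees of
its variables are unchanged, and its own out-degree is unchanged. [cite: LiYang2022, Lemma 3.11] -/
theorem ElimDataW.troubled_iff_of_fanouts {k₀ : Fin C.m} {P : Finset (Fin C.m × Fin C.m)} {δ : ℝ}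
    (E : ElimDataW C k₀ f R αφ αI αQ P δ) {k' : Fin E.C'.m} (h1 : ∀ a, C.arg (E.ι k') a ≠ .gate k₀)
    (hfv : ∀ a i, C.arg (E.ι k') a = .var i → E.C'.fanout (.var i) = C.fanout (.var i))
    (hfg : E.C'.fanout (.gate k') = C.fanout (.gate (E.ι k'))) :
    E.C'.Troubled k' ↔ C.Troubled (E.ι k') := by
  have hw := E.arg_eq_var_iff_of_not_reads h1
  have hrange := ElimDataW.range_eq_pair_iff (C.arg (E.ι k')) (E.C'.arg k') hw
  have hmemx : ∀ {x y : Fin n}, Set.range (C.arg (E.ι k')) = {Node.var x, Node.var y} → ∃ a, C.arg (E.ι k') a = .var x := by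
    intro x y hr
    have : (Node.var x : Node n C.m) ∈ Set.range (C.arg (E.ι k')) := by rw [hr]; exact Or.inl rfl
    exact this
  have hmemy : ∀ {x y : Fin n}, Set.range (C.arg (E.ι k')) = {Node.var x, Node.var y} → ∃ a, C.arg (E.ι k') a = .var y := by
    intro x y hr
    have : (Node.var y : Node n C.m) ∈ Set.range (C.arg (E.ι k')) := by rw [hr]; exact Or.inr rfl
    exact this
  have hfv' : ∀ i, (∃ a, C.arg (E.ι k') a = .var i) → E.C'.fanout (.var i) = C.fanout (.var i) :=
    fun i ⟨a, ha⟩ => hfv a i ha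
  constructor
  · rintro ⟨hand, hf1, x, y, hxy, hr, hx, hy⟩
    have hrC := (hrange x y).mp hr
    refine ⟨(E.isAndOp_iff k').mp hand, by rw [← hfg]; exact hf1, x, y, hxy, hrC, ?_, ?_⟩
    · rw [← hfv' x (hmemx hrC)]; exact hx
    · rw [← hfv' y (hmemy hrC)]; exact hy
  · rintro ⟨hand, hf1, x, y, hxy, hr, hx, hy⟩
    refine ⟨(E.isAndOp_iff k').mpr hand, by rw [hfg]; exact hf1, x, y, hxy, (hrange x y).mpr hr, ?_, ?_⟩
    · rw [hfv' x (hmemx hr)]; exact hx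
    · rw [hfv' y (hmemy hr)]; exact hy

section Readers

variable (hcfg : C.Case5Config G x y B C' D aX aB aC aD)
include hcfg

/-- The readers of `x` are `G` and `B`. [cite: LiYang2022, §4.1 (Case 5)] -/
theorem case5_reader_x {E : Fin C.m} {a : Fin 2} (h : C.arg E a = .var x) : E = G ∨ E = B := by
  classical
  by_contra hno
  rw [not_or] at hno
  have h3 : ({G, B, E} : Finset (Fin C.m)) ⊆ univ := subset_univ _
  have hnot : G ∉ ({B, E} : Finset (Fin C.m)) := by
    rw [mem_insert, mem_singleton, not_or]; exact ⟨hcfg.B_ne_G.symm, fun h => hno.1 h.symm⟩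
  have := sum_le_sum_of_subset_of_nonneg h3 (f := fun k => (univ.filter fun a : Fin 2 => C.arg k a = Node.var x).card)
    (fun _ _ _ => Nat.zero_le _)
  rw [sum_insert hnot, sum_pair (fun h => hno.2 h.symm)] at this
  have hG1 : 1 ≤ (univ.filter fun a : Fin 2 => C.arg G a = .var x).card :=
    card_pos.mpr ⟨aX, mem_filter.mpr ⟨mem_univ _, hcfg.arg_G_x⟩⟩
  have hB1 : 1 ≤ (univ.filter fun a : Fin 2 => C.arg B a = .var x).card :=
    card_pos.mpr ⟨aB, mem_filter.mpr ⟨mem_univ _, hcfg.arg_B⟩⟩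
  have hE1 : 1 ≤ (univ.filter fun a' : Fin 2 => C.arg E a' = .var x).card :=
    card_pos.mpr ⟨a, mem_filter.mpr ⟨mem_univ _, h⟩⟩
  have hfan := hcfg.fanout_x
  unfold fanout at hfan
  omega

/-- The readers of `y` are `G` and `C'`. [cite: LiYang2022, §4.1 (Case 5)] -/
theorem case5_reader_y {E : Fin C.m} {a : Fin 2} (h : C.arg E a = .var y) : E = G ∨ E = C' :=
  case5_reader_x hcfg.symm h

/-- `B` is outside the xor-part when it reads the acyclic gate `D`. [folklore] -/
theorem case5_B_not_mem (hDB : C.Reads D B) : B ∉ C.xorPart := by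
  obtain ⟨a, ha⟩ := hDB
  intro hBK
  have hDK : D ∈ C.xorPart := C.mem_of_arg_eq B hBK a D ha
  exact hcfg.G_not_mem (C.mem_of_arg_eq D hDK aD G hcfg.arg_D)

end Readers

/-- **Case 5.2 of the proof of Thm. 4.1.** [cite: LiYang2022, §4.1 (Case 5.2)] -/
theorem LiYang2022_case5_2_holds_aux (hf : IsAffineDisperser f d) (hd : 2 * d + 2 < R.dim) (hF : C.Fair)
    (hC : C.ComputesRestr f R) (hS : C.Standing R) (hcfg : C.Case5Config G x y B C' D aX aB aC aD)
    (hφ0 : 0 < αφ) (hφ : αφ < 1 / 2) (hI0 : 0 < αI) (αQ : ℝ)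
    (hBC : B ≠ C') (hDB : C.arg B aB.rev = .gate D) (hDC : C.arg C' aC.rev = .gate D) :
    C.StepGoal f R αφ αI αQ := by
  classical
  have hφ' := hφ0.le
  have hI' := hI0.le
  have hN := hS.normalized.1
  have hGK := hcfg.G_not_mem
  have hDK : D ∉ C.xorPart := fun hDK => hGK (C.mem_of_arg_eq D hDK aD G hcfg.arg_D)
  have hBK : B ∉ C.xorPart := case5_B_not_mem hcfg ⟨aB.rev, hDB⟩
  have hCK : C' ∉ C.xorPart := fun hCK => hDK (C.mem_of_arg_eq C' hCK _ D hDC)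
  have hxp := case5_unprot_x hS hcfg
  have hyp := case5_unprot_y hS hcfg
  -- the other wire `I` of `D`
  have hIG := case5_arg_D_rev_ne_G hS hcfg
  have hIx := case5_D_not_x hS hcfg aD.rev
  have hIy := case5_D_not_y hS hcfg aD.rev
  have hIB : C.arg D aD.rev ≠ .gate B := fun h => not_reads_of_reads hDK ⟨aB.rev, hDB⟩ ⟨aD.rev, h⟩
  have hIC : C.arg D aD.rev ≠ .gate C' := fun h => not_reads_of_reads hDK ⟨aC.rev, hDC⟩ ⟨aD.rev, h⟩
  have hID : C.arg D aD.rev ≠ .gate D := C.arg_ne_self_of_not_mem hDK _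
  have hIc : ∀ b, C.arg D aD.rev ≠ .const b := fun b => hN.arg_ne_const D _ b
  -- (1) the alternative configuration: an ∧-gate `E` reads the `1`-gate `B` and a variable `z`
  by_cases hAlt : ∃ (E : Fin C.m) (aE : Fin 2) (z : Fin n), IsAndOp (C.op E) ∧ C.arg E aE = .gate B ∧
      C.arg E aE.rev = .var z ∧ C.fanout (.gate B) = 1
  · obtain ⟨E, aE, z, hEand, hEB, hEz, hB1⟩ := hAlt
    have hEK : E ∉ C.xorPart := C.not_mem_xorPart_of_isAndOp hEand
    have hEG : E ≠ G := by
      intro h; rw [h] at hEB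
      rcases fin2_eq_or_eq_rev aX aE with e | e
      · rw [e, hcfg.arg_G_x] at hEB; cases hEB
      · rw [e, hcfg.arg_G_y] at hEB; cases hEB
    have hEB' : E ≠ B := fun h => by rw [h] at hEB; exact C.arg_ne_self_of_not_mem hBK _ hEB
    have hxz : x ≠ z := by
      intro h; rw [← h] at hEz
      rcases case5_reader_x hcfg hEz with h' | h'
      · exact hEG h'
      · exact hEB' h'
    have hyz : y ≠ z := by
      intro h; rw [← h] at hEz
      rcases case5_reader_y hcfg hEz with h' | h'
      · exact hEG h'
      · -- `E = C'` reads `B`: but `C'` reads `y` and `D`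
        rw [h'] at hEB
        rcases fin2_eq_or_eq_rev aC aE with e | e
        · rw [e, hcfg.arg_C] at hEB; cases hEB
        · rw [e, hDC] at hEB; cases hEB; exact case5_B_ne_D hS hcfg rfl
    have hGx' : C.arg G aX.rev.rev = .var x := by rw [Fin.rev_rev]; exact hcfg.arg_G_x
    have hEB'' : C.arg E aE.rev.rev = .gate B := by rw [Fin.rev_rev]; exact hEB
    exact stepGoal_two_consts hf hd hF hC hS hφ' (by linarith) hI' αQ hcfg.and_G hcfg.arg_G_y hGx' hEand hEz hEB''
      hcfg.arg_B hB1 hcfg.fanout_x hcfg.x_ne_y hxz hyz hEG hcfg.B_ne_G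
  · push Not at hAlt
    -- the chain
    have hkD : (case5E₁ hf hd hF hC hS hcfg hφ' hI' αQ).ι (case5kD hf hd hF hC hS hcfg hφ' hI' αQ) = D := case5kD_spec hf hd hF hC hS hcfg hφ' hI' αQ
    have hkB₁ : (case5E₁ hf hd hF hC hS hcfg hφ' hI' αQ).ι (case5kB₁ hf hd hF hC hS hcfg hφ' hI' αQ) = B := case5kB₁_spec hf hd hF hC hS hcfg hφ' hI' αQ
    have hkB : (case5E₂ hf hd hF hC hS hcfg hφ' hI' αQ).ι (case5kB hf hd hF hC hS hcfg hφ' hI' αQ) = (case5kB₁ hf hd hF hC hS hcfg hφ' hI' αQ) := case5kB_spec hf hd hF hC hS hcfg hφ' hI' αQ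
    have hd₁ : 2 * d + 2 ≤ (case5R₁ hC hS hcfg).dim := (case5R₁_dim hC hS hcfg).mpr hd
    have hrepl₁ : (case5E₁ hf hd hF hC hS hcfg hφ' hI' αQ).repl = .const ((case5C₁ hcfg).liveFn G aX (case5b hcfg) false) := case5E₁_repl hf hd hF hC hS hcfg hφ' hI' αQ
    -- wires of `C₁`
    have hC₁var : ∀ {k : Fin C.m} {a : Fin 2} {v : Fin n}, (case5C₁ hcfg).arg k a = .var v ↔ C.arg k a = .var v ∧ v ≠ x := by
      intro k a v
      rw [case5C₁_arg]
      cases hka : C.arg k a with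
      | const c => exact ⟨(fun h => by cases h), fun h => by cases h.1⟩
      | var i =>
        by_cases hix : i = x
        · rw [hix, Node.substConst_var_self]
          exact ⟨(fun h => by cases h), fun h => absurd (Node.var.inj h.1).symm h.2⟩
        · rw [Node.substConst_var_of_ne hix]
          exact ⟨(fun h => ⟨h, by cases h; exact hix⟩), fun h => h.1⟩
      | gate g => exact ⟨(fun h => by cases h), fun h => by cases h.1⟩
    have hC₁gate : ∀ {k : Fin C.m} {a : Fin 2} {g : Fin C.m}, (case5C₁ hcfg).arg k a = .gate g ↔ C.arg k a = .gate g := by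
      intro k a g
      rw [case5C₁_arg]
      cases hka : C.arg k a with
      | const c => exact ⟨(fun h => by cases h), fun h => by cases h⟩
      | var i =>
        by_cases hix : i = x
        · rw [hix, Node.substConst_var_self]; exact ⟨(fun h => by cases h), fun h => by cases h⟩
        · rw [Node.substConst_var_of_ne hix]
      | gate g' => exact Iff.rfl
    have hC₁const : ∀ {k : Fin C.m} {a : Fin 2} {b : Bool}, (case5C₁ hcfg).arg k a = .const b → C.arg k a = .var x := by
      intro k a b h
      rw [case5C₁_arg] at h
      cases hka : C.arg k a with
      | const c => exact absurd hka (hN.arg_ne_const k a c)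
      | var i =>
        rw [hka] at h
        by_cases hix : i = x
        · rw [hix]
        · rw [Node.substConst_var_of_ne hix] at h; cases h
      | gate g' => rw [hka] at h; cases h
    -- wires of `(case5kD hf hd hF hC hS hcfg hφ' hI' αQ)`, `(case5kB₁ hf hd hF hC hS hcfg hφ' hI' αQ)`, `(case5kB hf hd hF hC hS hcfg hφ' hI' αQ)`
    have hkDc := case5_arg_kD hf hd hF hC hS hcfg hφ' hI' αQ
    have hkDrev : (case5E₁ hf hd hF hC hS hcfg hφ' hI' αQ).C'.arg (case5kD hf hd hF hC hS hcfg hφ' hI' αQ) aD.rev = (case5E₁ hf hd hF hC hS hcfg hφ' hI' αQ).pull (C.arg D aD.rev) := case5_arg_kD_rev hf hd hF hC hS hcfg hφ' hI' αQ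
    have hkB₁c := case5_arg_kB₁ hf hd hF hC hS hcfg hφ' hI' αQ
    have hkBc := case5_arg_kB hf hd hF hC hS hcfg hφ' hI' αQ
    have hB₁rev : (case5E₁ hf hd hF hC hS hcfg hφ' hI' αQ).C'.arg (case5kB₁ hf hd hF hC hS hcfg hφ' hI' αQ) aB.rev = .gate (case5kD hf hd hF hC hS hcfg hφ' hI' αQ) := by
      rw [(case5E₁ hf hd hF hC hS hcfg hφ' hI' αQ).arg_eq_gate_iff, hkB₁, hkD]; left
      exact hC₁gate.mpr hDB
    have hB₂rev : (case5E₂ hf hd hF hC hS hcfg hφ' hI' αQ).C'.arg (case5kB hf hd hF hC hS hcfg hφ' hI' αQ) aB.rev = (case5E₂ hf hd hF hC hS hcfg hφ' hI' αQ).pull (case5E₂ hf hd hF hC hS hcfg hφ' hI' αQ).repl := by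
      rw [(case5E₂ hf hd hF hC hS hcfg hφ' hI' αQ).arg_eq', hkB, hB₁rev, if_pos rfl]
    have hrepl₂ := case5E₂_repl_cases hf hd hF hC hS hcfg hφ' hI' αQ
    -- `C'` along the chain
    obtain ⟨kC₁, hkC₁⟩ := (case5E₁ hf hd hF hC hS hcfg hφ' hI' αQ).ι_surj C' hcfg.C_ne_G
    have hkC₁D : kC₁ ≠ (case5kD hf hd hF hC hS hcfg hφ' hI' αQ) := by
      intro h; have := congrArg (case5E₁ hf hd hF hC hS hcfg hφ' hI' αQ).ι h; rw [hkC₁, hkD] at this; exact case5_C_ne_D hS hcfg this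
    obtain ⟨kC₂, hkC₂⟩ := (case5E₂ hf hd hF hC hS hcfg hφ' hI' αQ).ι_surj kC₁ hkC₁D
    have hkC₂B : kC₂ ≠ (case5kB hf hd hF hC hS hcfg hφ' hI' αQ) := by
      intro h; have := congrArg (case5E₂ hf hd hF hC hS hcfg hφ' hI' αQ).ι h; rw [hkC₂, hkB] at this
      have := congrArg (case5E₁ hf hd hF hC hS hcfg hφ' hI' αQ).ι this; rw [hkC₁, hkB₁] at this; exact hBC this.symm
    obtain ⟨kC₃, hkC₃⟩ := (case5E₃ hf hd hF hC hS hcfg hφ' hI' αQ).ι_surj kC₂ hkC₂B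
    have hkC₁y : (case5E₁ hf hd hF hC hS hcfg hφ' hI' αQ).C'.arg kC₁ aC = .var y := by
      rw [(case5E₁ hf hd hF hC hS hcfg hφ' hI' αQ).arg_eq_var_iff, hkC₁]; left; exact hC₁var.mpr ⟨hcfg.arg_C, fun h => hcfg.x_ne_y h.symm⟩
    have hkC₂y : (case5E₂ hf hd hF hC hS hcfg hφ' hI' αQ).C'.arg kC₂ aC = .var y := by rw [(case5E₂ hf hd hF hC hS hcfg hφ' hI' αQ).arg_eq_var_iff, hkC₂]; exact Or.inl hkC₁y
    have hkC₃y : (case5E₃ hf hd hF hC hS hcfg hφ' hI' αQ).C'.arg kC₃ aC = .var y := by rw [(case5E₃ hf hd hF hC hS hcfg hφ' hI' αQ).arg_eq_var_iff, hkC₃]; exact Or.inl hkC₂y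
    -- out-degrees after step 1
    have hfanD₁ : (case5E₁ hf hd hF hC hS hcfg hφ' hI' αQ).C'.fanout (.gate (case5kD hf hd hF hC hS hcfg hφ' hI' αQ)) = C.fanout (.gate D) := by
      rw [(case5E₁ hf hd hF hC hS hcfg hφ' hI' αQ).fanout_gate_eq (fun a h => ?_) (by rw [hrepl₁]; exact fun h => by cases h), hkD, C.fanout_substConst_gate]
      rw [hkD] at h
      rcases fin2_eq_or_eq_rev aX a with e | e
      · rw [e, case5C₁_arg_G] at h; cases h
      · rw [e, case5C₁_arg_G_rev] at h; cases h
    have hfanB₁ : (case5E₁ hf hd hF hC hS hcfg hφ' hI' αQ).C'.fanout (.gate (case5kB₁ hf hd hF hC hS hcfg hφ' hI' αQ)) = C.fanout (.gate B) := by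
      rw [(case5E₁ hf hd hF hC hS hcfg hφ' hI' αQ).fanout_gate_eq (fun a h => ?_) (by rw [hrepl₁]; exact fun h => by cases h), hkB₁, C.fanout_substConst_gate]
      rw [hkB₁] at h
      rcases fin2_eq_or_eq_rev aX a with e | e
      · rw [e, case5C₁_arg_G] at h; cases h
      · rw [e, case5C₁_arg_G_rev] at h; cases h
    have hfanu₁ : ∀ {u : Fin n}, u ≠ x → u ≠ y → (case5E₁ hf hd hF hC hS hcfg hφ' hI' αQ).C'.fanout (.var u) = C.fanout (.var u) := by
      intro u hux huy
      rw [(case5E₁ hf hd hF hC hS hcfg hφ' hI' αQ).fanout_var_eq (fun a h => ?_) (by rw [hrepl₁]; exact fun h => by cases h), C.fanout_substConst_var_of_ne x _ hux]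
      rcases fin2_eq_or_eq_rev aX a with e | e
      · rw [e, case5C₁_arg_G] at h; cases h
      · rw [e, case5C₁_arg_G_rev] at h; cases h; exact huy rfl
    -- a gate of `(case5E₁ hf hd hF hC hS hcfg hφ' hI' αQ).C'` other than `(case5kB₁ hf hd hF hC hS hcfg hφ' hI' αQ)` reading the constant is not ... (we only need: troubled gates read no constant)
    -- STEP 2 introduces no troubled gate
    have h₂ : ∀ T, (case5E₂ hf hd hF hC hS hcfg hφ' hI' αQ).C'.Troubled T → (case5E₁ hf hd hF hC hS hcfg hφ' hI' αQ).C'.Troubled ((case5E₂ hf hd hF hC hS hcfg hφ' hI' αQ).ι T) := by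
      intro T hT'
      by_contra hT
      obtain ⟨a, ha⟩ := (case5E₂ hf hd hF hC hS hcfg hφ' hI' αQ).causedBy_of_new_troubled T hT' hT
      rcases fin2_eq_or_eq_rev aD a with e | e
      · rw [e, hkDc] at ha; exact not_causedBy_const ha
      rw [e, hkDrev] at ha
      cases hI : C.arg D aD.rev with
      | const b => exact hIc b hI
      | gate gI =>
        -- `T` is `gI`; its out-degree is too large, or Case 3 in `C`
        rw [hI] at ha
        have hgIG : gI ≠ G := fun h => hIG (by rw [hI, h])
        obtain ⟨kI₁, hkI₁⟩ := (case5E₁ hf hd hF hC hS hcfg hφ' hI' αQ).ι_surj gI hgIG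
        have hpI : (case5E₁ hf hd hF hC hS hcfg hφ' hI' αQ).pull (.gate gI) = .gate kI₁ := by rw [← hkI₁]; exact (case5E₁ hf hd hF hC hS hcfg hφ' hI' αQ).pull_ι kI₁
        rw [hpI] at ha
        rcases ha with ha | ⟨z, hz, -⟩
        swap; · cases hz
        have hTι : (case5E₂ hf hd hF hC hS hcfg hφ' hI' αQ).ι T = kI₁ := (Node.gate.inj ha).symm
        obtain ⟨hand', hf1', x', y', hxy', hr', hx', hy'⟩ := hT'
        -- `gI` does not read `G`, so its wires are pulled back
        have hgIwires : ∀ a', C.arg gI a' ≠ .gate G := by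
          intro a' h
          -- readers of `G`: only `D` (fanout 1)
          have := two_le_fanout h hcfg.arg_D (fun h' => hID (by rw [hI, h']))
          have := hcfg.fanout_G; omega
        have hkI₁wires : ∀ a', (case5C₁ hcfg).arg ((case5E₁ hf hd hF hC hS hcfg hφ' hI' αQ).ι kI₁) a' ≠ .gate G := by
          intro a'; rw [hkI₁]; exact fun h => hgIwires a' (hC₁gate.mp h)
        have hfanI₁ : (case5E₁ hf hd hF hC hS hcfg hφ' hI' αQ).C'.fanout (.gate kI₁) = C.fanout (.gate gI) := by
          rw [(case5E₁ hf hd hF hC hS hcfg hφ' hI' αQ).fanout_gate_eq (fun a' h => ?_) (by rw [hrepl₁]; exact fun h => by cases h), hkI₁, C.fanout_substConst_gate]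
          rw [hkI₁] at h
          rcases fin2_eq_or_eq_rev aX a' with e' | e'
          · rw [e', case5C₁_arg_G] at h; cases h
          · rw [e', case5C₁_arg_G_rev] at h; cases h
        have hDreads : 1 ≤ C.fanout (.gate gI) := one_le_fanout_of_arg_eq hI
        have hcountI : (univ.filter fun a' : Fin 2 => (case5E₁ hf hd hF hC hS hcfg hφ' hI' αQ).C'.arg (case5kD hf hd hF hC hS hcfg hφ' hI' αQ) a' = .gate kI₁).card = 1 := by
          rw [card_eq_one]; refine ⟨aD.rev, ?_⟩; ext a'
          rw [mem_filter, mem_singleton]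
          constructor
          · intro h
            rcases fin2_eq_or_eq_rev aD a' with e' | e'
            · have := h.2; rw [e', hkDc] at this; cases this
            · exact e'
          · rintro rfl; exact ⟨mem_univ _, by rw [hkDrev, hI, hpI]⟩
        rcases hrepl₂ with ⟨b₂, hb₂⟩ | hr₂
        · -- `D` trivialized: `fanout(T) = fanout(gI) - 1 = 1`, so `gI` is an ∧-gate of out-degree 2 on a 2-variable
          have hfT : (case5E₂ hf hd hF hC hS hcfg hφ' hI' αQ).C'.fanout (.gate T) + 1 = C.fanout (.gate gI) := by
            have h1 := (case5E₂ hf hd hF hC hS hcfg hφ' hI' αQ).fanout_gate_add (k' := T) (by rw [hb₂]; exact fun h => by cases h)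
            rw [hTι, hfanI₁, hcountI] at h1
            omega
          rw [hf1'] at hfT
          -- a variable wire of `T` comes from a `2`-variable wire of `gI` in `C`
          obtain ⟨v, hv⟩ : ∃ v, (case5E₂ hf hd hF hC hS hcfg hφ' hI' αQ).C'.arg T 0 = .var v := ⟨_, (Troubled.arg_isVar ⟨hand', hf1', x', y', hxy', hr', hx', hy'⟩ 0).choose_spec⟩
          have hfv : (case5E₂ hf hd hF hC hS hcfg hφ' hI' αQ).C'.fanout (.var v) = 2 := Troubled.fanout_eq_two ⟨hand', hf1', x', y', hxy', hr', hx', hy'⟩ hv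
          have hv₁ : (case5E₁ hf hd hF hC hS hcfg hφ' hI' αQ).C'.arg kI₁ 0 = .var v := by
            rw [(case5E₂ hf hd hF hC hS hcfg hφ' hI' αQ).arg_eq_var_iff, hTι] at hv
            rcases hv with hv | ⟨-, hv⟩
            · exact hv
            · rw [hb₂] at hv; cases hv
          have hv₀ : C.arg gI 0 = .var v ∧ v ≠ x := by
            rw [(case5E₁ hf hd hF hC hS hcfg hφ' hI' αQ).arg_eq_var_iff, hkI₁] at hv₁
            rcases hv₁ with hv₁ | ⟨h, -⟩
            · exact hC₁var.mp hv₁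
            · exact absurd (hC₁gate.mp h) (hgIwires 0)
          have hvy : v ≠ y := by
            intro h; rw [h] at hv₀
            rcases case5_reader_y hcfg hv₀.1 with h' | h'
            · exact hgIG h'
            · exact hIC (by rw [hI, h'])
          have hfv₁ : (case5E₁ hf hd hF hC hS hcfg hφ' hI' αQ).C'.fanout (.var v) = C.fanout (.var v) := hfanu₁ hv₀.2 hvy
          have hfv₂ : (case5E₂ hf hd hF hC hS hcfg hφ' hI' αQ).C'.fanout (.var v) = (case5E₁ hf hd hF hC hS hcfg hφ' hI' αQ).C'.fanout (.var v) := by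
            refine (case5E₂ hf hd hF hC hS hcfg hφ' hI' αQ).fanout_var_eq (fun a' h => ?_) (by rw [hb₂]; exact fun h => by cases h)
            rcases fin2_eq_or_eq_rev aD a' with e' | e'
            · rw [e', hkDc] at h; cases h
            · rw [e', hkDrev, hI, hpI] at h; cases h
          have handC : IsAndOp (C.op gI) := by
            have := ((case5E₂ hf hd hF hC hS hcfg hφ' hI' αQ).isAndOp_iff T).mp hand'; rw [hTι] at this
            have := ((case5E₁ hf hd hF hC hS hcfg hφ' hI' αQ).isAndOp_iff kI₁).mp this; rwa [hkI₁] at this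
          have h3 := hS.and_fanout_le v gI 0 hv₀.1 handC
          rw [← hfv₁, ← hfv₂, hfv] at h3
          omega
        · -- `D` degenerate: `fanout(T) + 1 = fanout(gI) + fanout(D) ≥ 3`
          have hr₂' : (case5E₂ hf hd hF hC hS hcfg hφ' hI' αQ).repl = .gate kI₁ := by rw [hr₂, hI, hpI]
          have h1 := (case5E₂ hf hd hF hC hS hcfg hφ' hI' αQ).fanout_repl_add
          rw [hr₂', show (case5E₂ hf hd hF hC hS hcfg hφ' hI' αQ).pull (.gate kI₁) = .gate T from by rw [← hTι]; exact (case5E₂ hf hd hF hC hS hcfg hφ' hI' αQ).pull_ι T, hfanI₁, hfanD₁] at h1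
          have hD2 : 2 ≤ C.fanout (.gate D) := two_le_fanout hDB hDC hBC
          rw [hcountI, hf1'] at h1
          omega
      | var u =>
        rw [hI] at ha
        have hux : u ≠ x := fun h => hIx (by rw [hI, h])
        have huy : u ≠ y := fun h => hIy (by rw [hI, h])
        rcases ha with ha | ⟨z, hz, a', ha'⟩
        · cases ha
        cases hz
        have hfu : (case5E₂ hf hd hF hC hS hcfg hφ' hI' αQ).C'.fanout (.var u) = 2 := Troubled.fanout_eq_two hT' ha'
        have hfu₁ : (case5E₁ hf hd hF hC hS hcfg hφ' hI' αQ).C'.fanout (.var u) = C.fanout (.var u) := hfanu₁ hux huy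
        have hcount : (univ.filter fun a'' : Fin 2 => (case5E₁ hf hd hF hC hS hcfg hφ' hI' αQ).C'.arg (case5kD hf hd hF hC hS hcfg hφ' hI' αQ) a'' = .var u).card = 1 := by
          rw [card_eq_one]; refine ⟨aD.rev, ?_⟩; ext a''
          rw [mem_filter, mem_singleton]
          constructor
          · intro h
            rcases fin2_eq_or_eq_rev aD a'' with e' | e'
            · have := h.2; rw [e', hkDc] at this; cases this
            · exact e'
          · rintro rfl; refine ⟨mem_univ _, ?_⟩; rw [hkDrev, hI]; rfl
        have hDu : 1 ≤ C.fanout (.var u) := one_le_fanout_of_arg_eq hI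
        rcases hrepl₂ with ⟨b₂, hb₂⟩ | hr₂
        · -- `D` trivialized: `fanout_C(u) = 3`; the reader `T₀` of `u` is an ∧-gate: Case 3 makes it the output
          have h1 := (case5E₂ hf hd hF hC hS hcfg hφ' hI' αQ).fanout_var_add (i := u) (by rw [hb₂]; exact fun h => by cases h)
          rw [hcount, hfu, hfu₁] at h1
          -- `T` reads `u` directly (the other possibility needs `repl = u`)
          rw [(case5E₂ hf hd hF hC hS hcfg hφ' hI' αQ).arg_eq_var_iff] at ha'
          rcases ha' with ha' | ⟨-, ha'⟩
          swap; · rw [hb₂] at ha'; cases ha'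
          rw [(case5E₁ hf hd hF hC hS hcfg hφ' hI' αQ).arg_eq_var_iff] at ha'
          rcases ha' with ha' | ⟨-, ha'⟩
          swap; · rw [hrepl₁] at ha'; cases ha'
          have hT₀u := (hC₁var.mp ha').1
          have handC : IsAndOp (C.op ((case5E₁ hf hd hF hC hS hcfg hφ' hI' αQ).ι ((case5E₂ hf hd hF hC hS hcfg hφ' hI' αQ).ι T))) := ((case5E₁ hf hd hF hC hS hcfg hφ' hI' αQ).isAndOp_iff _).mp (((case5E₂ hf hd hF hC hS hcfg hφ' hI' αQ).isAndOp_iff T).mp hT'.1)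
          have h3 := hS.and_fanout_le u _ a' hT₀u handC
          have hT0 : C.fanout (.gate ((case5E₁ hf hd hF hC hS hcfg hφ' hI' αQ).ι ((case5E₂ hf hd hF hC hS hcfg hφ' hI' αQ).ι T))) = 0 := by omega
          exact false_of_and_out_reads_var hf (by omega) hF hC (hN.out_of_fanout_eq_zero _ hT0) handC hT₀u
        · -- `D` degenerate, passing `u`: `fanout(u) + 1 = fanout_C(u) + fanout_C(D)`, so `fanout_C(u) = 1`, `fanout_C(D) = 2`
          have hr₂' : (case5E₂ hf hd hF hC hS hcfg hφ' hI' αQ).repl = .var u := by rw [hr₂, hI]; rfl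
          have h1 := (case5E₂ hf hd hF hC hS hcfg hφ' hI' αQ).fanout_repl_add
          rw [hr₂', show (case5E₂ hf hd hF hC hS hcfg hφ' hI' αQ).pull (.var u) = .var u from rfl, hcount, hfu, hfu₁, hfanD₁] at h1
          have hD2 : 2 ≤ C.fanout (.gate D) := two_le_fanout hDB hDC hBC
          have hCu : C.fanout (.var u) = 1 := by omega
          have hCD : C.fanout (.gate D) = 2 := by omega
          -- where does `T` read `u` from?
          rw [(case5E₂ hf hd hF hC hS hcfg hφ' hI' αQ).arg_eq_var_iff] at ha'
          rcases ha' with ha' | ⟨hTD, -⟩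
          · -- `T₀` reads `u` in `C`: it is `D`
            rw [(case5E₁ hf hd hF hC hS hcfg hφ' hI' αQ).arg_eq_var_iff] at ha'
            rcases ha' with ha' | ⟨-, ha'⟩
            swap; · rw [hrepl₁] at ha'; cases ha'
            have hT₀u := (hC₁var.mp ha').1
            have hT₀D : (case5E₁ hf hd hF hC hS hcfg hφ' hI' αQ).ι ((case5E₂ hf hd hF hC hS hcfg hφ' hI' αQ).ι T) ≠ D := by
              intro h
              have h' : (case5E₁ hf hd hF hC hS hcfg hφ' hI' αQ).ι ((case5E₂ hf hd hF hC hS hcfg hφ' hI' αQ).ι T) =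
                  (case5E₁ hf hd hF hC hS hcfg hφ' hI' αQ).ι (case5kD hf hd hF hC hS hcfg hφ' hI' αQ) := h.trans hkD.symm
              exact (case5E₂ hf hd hF hC hS hcfg hφ' hI' αQ).ι_ne T ((case5E₁ hf hd hF hC hS hcfg hφ' hI' αQ).ι_injective h')
            have := two_le_fanout hT₀u hI hT₀D
            omega
          · -- `T₀` reads `D` in `C`: it is `B` or `C'`
            rw [(case5E₁ hf hd hF hC hS hcfg hφ' hI' αQ).arg_eq_gate_iff, hkD] at hTD
            rcases hTD with hTD | ⟨-, hTD⟩
            swap; · rw [hrepl₁] at hTD; cases hTD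
            have hT₀D := hC₁gate.mp hTD
            by_cases hTB : (case5E₁ hf hd hF hC hS hcfg hφ' hI' αQ).ι ((case5E₂ hf hd hF hC hS hcfg hφ' hI' αQ).ι T) = B
            · -- `T = (case5kB hf hd hF hC hS hcfg hφ' hI' αQ)` reads a constant
              have hT₂ : (case5E₂ hf hd hF hC hS hcfg hφ' hI' αQ).ι T = (case5kB₁ hf hd hF hC hS hcfg hφ' hI' αQ) := (case5E₁ hf hd hF hC hS hcfg hφ' hI' αQ).ι_injective (hTB.trans hkB₁.symm)
              have hT₃ : T = (case5kB hf hd hF hC hS hcfg hφ' hI' αQ) := (case5E₂ hf hd hF hC hS hcfg hφ' hI' αQ).ι_injective (hT₂.trans hkB.symm)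
              rw [hT₃] at hT'
              exact not_troubled_of_reads_const hkBc hT'
            by_cases hTC : (case5E₁ hf hd hF hC hS hcfg hφ' hI' αQ).ι ((case5E₂ hf hd hF hC hS hcfg hφ' hI' αQ).ι T) = C'
            · have hT₂ : (case5E₂ hf hd hF hC hS hcfg hφ' hI' αQ).ι T = kC₁ := (case5E₁ hf hd hF hC hS hcfg hφ' hI' αQ).ι_injective (hTC.trans hkC₁.symm)
              have hT₃ : T = kC₂ := (case5E₂ hf hd hF hC hS hcfg hφ' hI' αQ).ι_injective (hT₂.trans hkC₂.symm)
              rw [hT₃] at hT'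
              exact case5_not_troubled_of_reads_y₂ hf hd hF hC hS hcfg hφ' hI' αQ hkC₂y hT'
            · have := three_le_fanout hDB hDC hT₀D hBC (fun h => hTB h.symm) (fun h => hTC h.symm)
              omega
    -- `(case5kB hf hd hF hC hS hcfg hφ' hI' αQ)` after step 2: out-degree of `B`
    have hkDwires : ∀ a, (case5E₁ hf hd hF hC hS hcfg hφ' hI' αQ).C'.arg (case5kD hf hd hF hC hS hcfg hφ' hI' αQ) a ≠ .gate (case5kB₁ hf hd hF hC hS hcfg hφ' hI' αQ) := by
      intro a h
      rcases fin2_eq_or_eq_rev aD a with e | e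
      · rw [e, hkDc] at h; cases h
      · rw [e, hkDrev] at h
        have := congrArg (case5E₁ hf hd hF hC hS hcfg hφ' hI' αQ).embed h
        rw [(case5E₁ hf hd hF hC hS hcfg hφ' hI' αQ).embed_pull hIG] at this
        exact hIB (this.trans (by show Node.gate ((case5E₁ hf hd hF hC hS hcfg hφ' hI' αQ).ι (case5kB₁ hf hd hF hC hS hcfg hφ' hI' αQ)) = _; rw [hkB₁]))
    have hrepl₂B : (case5E₂ hf hd hF hC hS hcfg hφ' hI' αQ).repl ≠ .gate (case5kB₁ hf hd hF hC hS hcfg hφ' hI' αQ) := by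
      rcases hrepl₂ with ⟨b₂, hb₂⟩ | hr₂
      · rw [hb₂]; exact fun h => by cases h
      · rw [hr₂]; intro h
        have := congrArg (case5E₁ hf hd hF hC hS hcfg hφ' hI' αQ).embed h
        rw [(case5E₁ hf hd hF hC hS hcfg hφ' hI' αQ).embed_pull hIG] at this
        exact hIB (this.trans (by show Node.gate ((case5E₁ hf hd hF hC hS hcfg hφ' hI' αQ).ι (case5kB₁ hf hd hF hC hS hcfg hφ' hI' αQ)) = _; rw [hkB₁]))
    have hB2fan : (case5E₂ hf hd hF hC hS hcfg hφ' hI' αQ).C'.fanout (.gate (case5kB hf hd hF hC hS hcfg hφ' hI' αQ)) = C.fanout (.gate B) := by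
      rw [(case5E₂ hf hd hF hC hS hcfg hφ' hI' αQ).fanout_gate_eq (fun a => by rw [hkB]; exact hkDwires a) (by rw [hkB]; exact hrepl₂B), hkB, hfanB₁]
    -- `C'` reads `D` at `aC.rev`
    have hkC₁rev : (case5E₁ hf hd hF hC hS hcfg hφ' hI' αQ).C'.arg kC₁ aC.rev = .gate (case5kD hf hd hF hC hS hcfg hφ' hI' αQ) := by
      rw [(case5E₁ hf hd hF hC hS hcfg hφ' hI' αQ).arg_eq_gate_iff, hkC₁, hkD]; left; exact hC₁gate.mpr hDC
    have hkC₂rev : (case5E₂ hf hd hF hC hS hcfg hφ' hI' αQ).C'.arg kC₂ aC.rev = (case5E₂ hf hd hF hC hS hcfg hφ' hI' αQ).pull (case5E₂ hf hd hF hC hS hcfg hφ' hI' αQ).repl := by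
      rw [(case5E₂ hf hd hF hC hS hcfg hφ' hI' αQ).arg_eq', hkC₂, hkC₁rev, if_pos rfl]
    -- the output along the chain when `B` is the output
    have hout_of_B : C.out = .gate B → (case5E₂ hf hd hF hC hS hcfg hφ' hI' αQ).C'.out = .gate (case5kB hf hd hF hC hS hcfg hφ' hI' αQ) := by
      intro hout
      have h1 := (case5E₁ hf hd hF hC hS hcfg hφ' hI' αQ).out_eq
      have hC₁out : (case5C₁ hcfg).out = .gate B := by
        show (C.out).substConst x (finTwoEquiv (case5c hcfg)) = _; rw [hout]; rfl
      rw [hC₁out, if_neg (fun h => hcfg.B_ne_G (Node.gate.inj h))] at h1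
      have hout₁ : (case5E₁ hf hd hF hC hS hcfg hφ' hI' αQ).C'.out = .gate (case5kB₁ hf hd hF hC hS hcfg hφ' hI' αQ) := by
        apply (case5E₁ hf hd hF hC hS hcfg hφ' hI' αQ).embed_injective
        show (case5E₁ hf hd hF hC hS hcfg hφ' hI' αQ).C'.out.embed (case5E₁ hf hd hF hC hS hcfg hφ' hI' αQ).ι = (Node.gate (case5kB₁ hf hd hF hC hS hcfg hφ' hI' αQ) : Node n _).embed (case5E₁ hf hd hF hC hS hcfg hφ' hI' αQ).ι
        rw [h1]; show Node.gate B = Node.gate ((case5E₁ hf hd hF hC hS hcfg hφ' hI' αQ).ι (case5kB₁ hf hd hF hC hS hcfg hφ' hI' αQ)); rw [hkB₁]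
      have h2 := (case5E₂ hf hd hF hC hS hcfg hφ' hI' αQ).out_eq
      rw [hout₁, if_neg (fun h => (case5kB₁_ne hf hd hF hC hS hcfg hφ' hI' αQ) (Node.gate.inj h))] at h2
      apply (case5E₂ hf hd hF hC hS hcfg hφ' hI' αQ).embed_injective
      show (case5E₂ hf hd hF hC hS hcfg hφ' hI' αQ).C'.out.embed (case5E₂ hf hd hF hC hS hcfg hφ' hI' αQ).ι = (Node.gate (case5kB hf hd hF hC hS hcfg hφ' hI' αQ) : Node n _).embed (case5E₂ hf hd hF hC hS hcfg hφ' hI' αQ).ι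
      rw [h2]; show Node.gate (case5kB₁ hf hd hF hC hS hcfg hφ' hI' αQ) = Node.gate ((case5E₂ hf hd hF hC hS hcfg hφ' hI' αQ).ι (case5kB hf hd hF hC hS hcfg hφ' hI' αQ)); rw [hkB]
    -- `gI`: if the image of the gate input of `D` is troubled at the end, `gI` was troubled
    have hgI : ∀ gI, C.arg D aD.rev = .gate gI → ∀ T, (case5E₃ hf hd hF hC hS hcfg hφ' hI' αQ).C'.Troubled T → (case5E₁ hf hd hF hC hS hcfg hφ' hI' αQ).ι ((case5E₂ hf hd hF hC hS hcfg hφ' hI' αQ).ι ((case5E₃ hf hd hF hC hS hcfg hφ' hI' αQ).ι T)) = gI →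
        (case5C₁ hcfg).Troubled gI := by
      intro gI hI T hT hTgI
      have hgIG : gI ≠ G := fun h => hIG (by rw [hI, h])
      have hgID : gI ≠ D := fun h => hID (by rw [hI, h])
      have hgIB : gI ≠ B := fun h => hIB (by rw [hI, h])
      have hgIC : gI ≠ C' := fun h => hIC (by rw [hI, h])
      -- `gI` reads none of `G`, `D`, `B`, `x`
      have hgI_G : ∀ a, C.arg gI a ≠ .gate G := by
        intro a h
        have := two_le_fanout h hcfg.arg_D hgID
        have := hcfg.fanout_G; omega
      have hgI_D : ∀ a, C.arg gI a ≠ .gate D := fun a h => not_reads_of_reads hDK ⟨a, h⟩ ⟨aD.rev, hI⟩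
      have hgI_B : ∀ a, C.arg gI a ≠ .gate B := by
        intro a h
        by_cases hgIK : gI ∈ C.xorPart
        · exact hBK (C.mem_of_arg_eq gI hgIK a B h)
        · obtain ⟨ρ, hρ⟩ := C.acyclic
          have h1 := hρ gI hgIK a B h hBK
          have h2 := hρ D hDK aD.rev gI hI hgIK
          have h3 := hρ B hBK aB.rev D hDB hDK
          omega
      have hgI_x : ∀ a, C.arg gI a ≠ .var x := by
        intro a h
        rcases case5_reader_x hcfg h with h' | h'
        · exact hgIG h'
        · exact hgIB h'
      -- images
      set T₂ := (case5E₃ hf hd hF hC hS hcfg hφ' hI' αQ).ι T with hT₂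
      set T₁ := (case5E₂ hf hd hF hC hS hcfg hφ' hI' αQ).ι T₂ with hT₁
      have hw₁ : ∀ a, (case5C₁ hcfg).arg ((case5E₁ hf hd hF hC hS hcfg hφ' hI' αQ).ι T₁) a ≠ .gate G := by
        intro a; rw [hTgI]; exact fun h => hgI_G a (hC₁gate.mp h)
      have hw₂ : ∀ a, (case5E₁ hf hd hF hC hS hcfg hφ' hI' αQ).C'.arg ((case5E₂ hf hd hF hC hS hcfg hφ' hI' αQ).ι T₂) a ≠ .gate (case5kD hf hd hF hC hS hcfg hφ' hI' αQ) := by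
        intro a h
        rw [(case5E₁ hf hd hF hC hS hcfg hφ' hI' αQ).arg_eq_gate_iff, hkD] at h
        rcases h with h | ⟨h, -⟩
        · rw [hTgI] at h; exact hgI_D a (hC₁gate.mp h)
        · exact hw₁ a h
      have hw₃ : ∀ a, (case5E₂ hf hd hF hC hS hcfg hφ' hI' αQ).C'.arg ((case5E₃ hf hd hF hC hS hcfg hφ' hI' αQ).ι T) a ≠ .gate (case5kB hf hd hF hC hS hcfg hφ' hI' αQ) := by
        intro a h
        rw [(case5E₂ hf hd hF hC hS hcfg hφ' hI' αQ).arg_eq_gate_iff, hkB] at h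
        rcases h with h | ⟨h, -⟩
        · rw [(case5E₁ hf hd hF hC hS hcfg hφ' hI' αQ).arg_eq_gate_iff, hkB₁] at h
          rcases h with h | ⟨h, -⟩
          · rw [hTgI] at h; exact hgI_B a (hC₁gate.mp h)
          · exact hw₁ a h
        · exact hw₂ a h
      -- variable wires of `T` are variable wires of `gI`
      have hvar : ∀ a v, (case5E₃ hf hd hF hC hS hcfg hφ' hI' αQ).C'.arg T a = .var v → C.arg gI a = .var v ∧ v ≠ x ∧ v ≠ y := by
        intro a v h
        rw [(case5E₃ hf hd hF hC hS hcfg hφ' hI' αQ).arg_eq_var_iff_of_not_reads hw₃, (case5E₂ hf hd hF hC hS hcfg hφ' hI' αQ).arg_eq_var_iff_of_not_reads hw₂, (case5E₁ hf hd hF hC hS hcfg hφ' hI' αQ).arg_eq_var_iff_of_not_reads hw₁,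
          hTgI] at h
        obtain ⟨h1, h2⟩ := hC₁var.mp h
        refine ⟨h1, h2, fun hvy => ?_⟩
        rw [hvy] at h1
        rcases case5_reader_y hcfg h1 with h' | h'
        · exact hgIG h'
        · exact hgIC h'
      -- out-degrees of those variables are unchanged along the chain
      have hrepl₂var : ∀ v, (case5E₂ hf hd hF hC hS hcfg hφ' hI' αQ).repl ≠ .var v := by
        intro v h
        rcases hrepl₂ with ⟨b₂, hb₂⟩ | hr₂
        · rw [hb₂] at h; cases h
        · rw [hr₂, hI] at h
          obtain ⟨kI₁, hkI₁⟩ := (case5E₁ hf hd hF hC hS hcfg hφ' hI' αQ).ι_surj gI hgIG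
          rw [← hkI₁, (case5E₁ hf hd hF hC hS hcfg hφ' hI' αQ).pull_ι] at h; cases h
      have hkDvar : ∀ a v, (case5E₁ hf hd hF hC hS hcfg hφ' hI' αQ).C'.arg (case5kD hf hd hF hC hS hcfg hφ' hI' αQ) a ≠ .var v := by
        intro a v h
        rcases fin2_eq_or_eq_rev aD a with e | e
        · rw [e, hkDc] at h; cases h
        · rw [e, hkDrev, hI] at h
          obtain ⟨kI₁, hkI₁⟩ := (case5E₁ hf hd hF hC hS hcfg hφ' hI' αQ).ι_surj gI hgIG
          rw [← hkI₁, (case5E₁ hf hd hF hC hS hcfg hφ' hI' αQ).pull_ι] at h; cases h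
      have hkBvar : ∀ a v, (case5E₂ hf hd hF hC hS hcfg hφ' hI' αQ).C'.arg (case5kB hf hd hF hC hS hcfg hφ' hI' αQ) a ≠ .var v := by
        intro a v h
        rcases fin2_eq_or_eq_rev aB a with e | e
        · rw [e, hkBc] at h; cases h
        · rw [e, hB₂rev] at h
          rcases hrepl₂ with ⟨b₂, hb₂⟩ | hr₂
          · rw [hb₂] at h; cases h
          · rw [hr₂, hI] at h
            obtain ⟨kI₁, hkI₁⟩ := (case5E₁ hf hd hF hC hS hcfg hφ' hI' αQ).ι_surj gI hgIG
            have hkI₁D : kI₁ ≠ (case5kD hf hd hF hC hS hcfg hφ' hI' αQ) := by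
              intro h'; have := congrArg (case5E₁ hf hd hF hC hS hcfg hφ' hI' αQ).ι h'; rw [hkI₁, hkD] at this; exact hgID this
            obtain ⟨kI₂, hkI₂⟩ := (case5E₂ hf hd hF hC hS hcfg hφ' hI' αQ).ι_surj kI₁ hkI₁D
            rw [← hkI₁, (case5E₁ hf hd hF hC hS hcfg hφ' hI' αQ).pull_ι, ← hkI₂, (case5E₂ hf hd hF hC hS hcfg hφ' hI' αQ).pull_ι] at h; cases h
      have hrepl₃var : ∀ v, (case5E₃ hf hd hF hC hS hcfg hφ' hI' αQ).repl ≠ .var v := by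
        intro v h
        rcases (case5E₃ hf hd hF hC hS hcfg hφ' hI' αQ).repl_cases with ⟨b, hb⟩ | ⟨a, ha⟩
        · rw [hb] at h; cases h
        · rw [h] at ha; exact hkBvar a v ha
      have hfv : ∀ v, v ≠ x → v ≠ y → (case5E₃ hf hd hF hC hS hcfg hφ' hI' αQ).C'.fanout (.var v) = C.fanout (.var v) := by
        intro v hvx hvy
        rw [(case5E₃ hf hd hF hC hS hcfg hφ' hI' αQ).fanout_var_eq (fun a => hkBvar a v) (hrepl₃var v), (case5E₂ hf hd hF hC hS hcfg hφ' hI' αQ).fanout_var_eq (fun a => hkDvar a v) (hrepl₂var v)]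
        exact hfanu₁ hvx hvy
      -- `gI` in `C`: an ∧-gate reading two distinct `2`-variables, hence a troubled `1`-gate
      obtain ⟨hand, hf1, x', y', hxy', hr', hx', hy'⟩ := hT
      have handC : IsAndOp (C.op gI) := by
        have h := ((case5E₁ hf hd hF hC hS hcfg hφ' hI' αQ).isAndOp_iff _).mp (((case5E₂ hf hd hF hC hS hcfg hφ' hI' αQ).isAndOp_iff _).mp (((case5E₃ hf hd hF hC hS hcfg hφ' hI' αQ).isAndOp_iff T).mp hand))
        rwa [hTgI] at h
      obtain ⟨v₀, hv₀⟩ := Troubled.arg_isVar ⟨hand, hf1, x', y', hxy', hr', hx', hy'⟩ 0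
      obtain ⟨v₁, hv₁⟩ := Troubled.arg_isVar ⟨hand, hf1, x', y', hxy', hr', hx', hy'⟩ 1
      have hne01 := Troubled.arg_ne ⟨hand, hf1, x', y', hxy', hr', hx', hy'⟩ 0
      rw [show (0 : Fin 2).rev = 1 from rfl, hv₀, hv₁] at hne01
      have hv₀₁ : v₀ ≠ v₁ := fun h => hne01 (by rw [h])
      have hfv₀ := Troubled.fanout_eq_two ⟨hand, hf1, x', y', hxy', hr', hx', hy'⟩ hv₀
      have hfv₁ := Troubled.fanout_eq_two ⟨hand, hf1, x', y', hxy', hr', hx', hy'⟩ hv₁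
      obtain ⟨hC₀, hv₀x, hv₀y⟩ := hvar 0 v₀ hv₀
      obtain ⟨hC₁, hv₁x, hv₁y⟩ := hvar 1 v₁ hv₁
      rw [hfv v₀ hv₀x hv₀y] at hfv₀
      rw [hfv v₁ hv₁x hv₁y] at hfv₁
      have h3 := hS.and_fanout_le v₀ gI 0 hC₀ handC
      have h1' := one_le_fanout_of_arg_eq hI
      have hTC : C.Troubled gI := by
        refine ⟨handC, by omega, v₀, v₁, hv₀₁, ?_, hfv₀, hfv₁⟩
        ext w
        constructor
        · rintro ⟨a, rfl⟩
          rcases fin2_eq_or_eq_rev 0 a with e | e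
          · rw [e, hC₀]; exact Or.inl rfl
          · rw [e, show (0 : Fin 2).rev = 1 from rfl, hC₁]; exact Or.inr rfl
        · rintro (h | h)
          · exact ⟨0, by rw [hC₀]; exact h.symm⟩
          · exact ⟨1, by rw [hC₁]; exact h.symm⟩
      exact (C.troubled_substConst_iff_of_not_reads x _ hgI_x).mpr hTC
    -- a new troubled gate at the end reads the variable `u = I` passed by `D` and then by `B`
    have hnew : ∀ T, (case5E₃ hf hd hF hC hS hcfg hφ' hI' αQ).C'.Troubled T → ¬ (case5C₁ hcfg).Troubled ((case5E₁ hf hd hF hC hS hcfg hφ' hI' αQ).ι ((case5E₂ hf hd hF hC hS hcfg hφ' hI' αQ).ι ((case5E₃ hf hd hF hC hS hcfg hφ' hI' αQ).ι T))) →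
        ∃ u, C.arg D aD.rev = .var u ∧ (case5E₂ hf hd hF hC hS hcfg hφ' hI' αQ).repl = .var u ∧ ¬ (case5E₂ hf hd hF hC hS hcfg hφ' hI' αQ).C'.Troubled ((case5E₃ hf hd hF hC hS hcfg hφ' hI' αQ).ι T) ∧ ∃ a, (case5E₃ hf hd hF hC hS hcfg hφ' hI' αQ).C'.arg T a = .var u := by
      intro T hT hnT
      have hnT₂ : ¬ (case5E₂ hf hd hF hC hS hcfg hφ' hI' αQ).C'.Troubled ((case5E₃ hf hd hF hC hS hcfg hφ' hI' αQ).ι T) := fun h =>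
        hnT (case5E₁_noNew hf hd hF hC hS hcfg hφ' hI' αQ _ (h₂ _ h))
      obtain ⟨a, ha⟩ := (case5E₃ hf hd hF hC hS hcfg hφ' hI' αQ).causedBy_of_new_troubled T hT hnT₂
      rcases fin2_eq_or_eq_rev aB a with e | e
      · rw [e, hkBc] at ha; exact absurd ha not_causedBy_const
      rw [e, hB₂rev] at ha
      rcases hrepl₂ with ⟨b₂, hb₂⟩ | hr₂
      · rw [hb₂] at ha; exact absurd ha not_causedBy_const
      rw [hr₂] at ha
      cases hI : C.arg D aD.rev with
      | const b => exact absurd hI (hIc b)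
      | gate gI =>
        exfalso
        rw [hI] at ha hr₂
        have hgIG : gI ≠ G := fun h => hIG (by rw [hI, h])
        have hgID : gI ≠ D := fun h => hID (by rw [hI, h])
        obtain ⟨kI₁, hkI₁⟩ := (case5E₁ hf hd hF hC hS hcfg hφ' hI' αQ).ι_surj gI hgIG
        have hkI₁D : kI₁ ≠ (case5kD hf hd hF hC hS hcfg hφ' hI' αQ) := by
          intro h'; have := congrArg (case5E₁ hf hd hF hC hS hcfg hφ' hI' αQ).ι h'; rw [hkI₁, hkD] at this; exact hgID this
        obtain ⟨kI₂, hkI₂⟩ := (case5E₂ hf hd hF hC hS hcfg hφ' hI' αQ).ι_surj kI₁ hkI₁D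
        rw [← hkI₁, (case5E₁ hf hd hF hC hS hcfg hφ' hI' αQ).pull_ι, ← hkI₂, (case5E₂ hf hd hF hC hS hcfg hφ' hI' αQ).pull_ι] at ha
        rcases ha with ha | ⟨z, hz, -⟩
        swap; · cases hz
        have hT₂ : (case5E₃ hf hd hF hC hS hcfg hφ' hI' αQ).ι T = kI₂ := (Node.gate.inj ha).symm
        apply hnT
        have hpre : (case5E₁ hf hd hF hC hS hcfg hφ' hI' αQ).ι ((case5E₂ hf hd hF hC hS hcfg hφ' hI' αQ).ι ((case5E₃ hf hd hF hC hS hcfg hφ' hI' αQ).ι T)) = gI := by rw [hT₂, hkI₂, hkI₁]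
        rw [hpre]
        exact hgI gI hI T hT hpre
      | var u =>
        rw [hI] at ha hr₂
        rcases ha with ha | ⟨z, hz, a', ha'⟩
        · cases ha
        cases hz
        exact ⟨u, rfl, hr₂, hnT₂, a', ha'⟩
    -- (2)/(3): does the elimination of `B` replace its out-wires by a constant?
    by_cases hrepl₃ : ∃ b, (case5E₃ hf hd hF hC hS hcfg hφ' hI' αQ).repl = .const b
    · -- (2) the fourth elimination
      obtain ⟨b₃, hb₃⟩ := hrepl₃
      by_cases hB0 : C.fanout (.gate B) = 0
      · -- `B` is the output, which would become a constant
        exfalso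
        have hout := hN.out_of_fanout_eq_zero B hB0
        have hout₂ := hout_of_B hout
        have h3 := (case5E₃ hf hd hF hC hS hcfg hφ' hI' αQ).out_eq
        rw [hout₂, if_pos rfl, hb₃] at h3
        have hout₃ : (case5E₃ hf hd hF hC hS hcfg hφ' hI' αQ).C'.out = .const b₃ := (Node.embed_eq_const_iff (case5E₃ hf hd hF hC hS hcfg hφ' hI' αQ).ι).mp h3
        obtain ⟨ko, hko⟩ := exists_out_eq_gate' hf (case5E₃ hf hd hF hC hS hcfg hφ' hI' αQ).fair (case5E₃ hf hd hF hC hS hcfg hφ' hI' αQ).computes (by omega : 2 * d + 1 ≤ (case5R₁ hC hS hcfg).dim)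
        rw [hout₃] at hko; cases hko
      · obtain ⟨F, aF, hFB⟩ := exists_reader_of_fanout_pos (D := C) (by omega : 0 < C.fanout (.gate B))
        have hFG : F ≠ G := by
          intro h; rw [h] at hFB
          rcases fin2_eq_or_eq_rev aX aF with e | e
          · rw [e, hcfg.arg_G_x] at hFB; cases hFB
          · rw [e, hcfg.arg_G_y] at hFB; cases hFB
        have hFB' : F ≠ B := fun h => by rw [h] at hFB; exact C.arg_ne_self_of_not_mem hBK _ hFB
        have hFD : F ≠ D := by
          intro h; rw [h] at hFB
          rcases fin2_eq_or_eq_rev aD aF with e | e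
          · rw [e, hcfg.arg_D] at hFB; cases hFB; exact hcfg.B_ne_G rfl
          · rw [e] at hFB; exact hIB hFB
        refine case5_main4 hf hd hF hC hS hcfg hφ' hI' αQ ⟨b₃, hb₃⟩ hFB hFG hFD hFB' fun T T' hT hT' hnT hnT' => ?_
        obtain ⟨u, hIu, hr₂u, -, a, ha⟩ := hnew T hT hnT
        obtain ⟨u', hIu', -, -, a', ha'⟩ := hnew T' hT' hnT'
        have huu' : u' = u := by rw [hIu] at hIu'; cases hIu'; rfl
        rw [huu'] at ha'
        -- `kC₃` reads `u` too
        have hkC₂u : (case5E₂ hf hd hF hC hS hcfg hφ' hI' αQ).C'.arg kC₂ aC.rev = .var u := by rw [hkC₂rev, hr₂u]; rfl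
        have hkC₃u : (case5E₃ hf hd hF hC hS hcfg hφ' hI' αQ).C'.arg kC₃ aC.rev = .var u := by rw [(case5E₃ hf hd hF hC hS hcfg hφ' hI' αQ).arg_eq_var_iff, hkC₃]; exact Or.inl hkC₂u
        have hTC : T ≠ kC₃ := fun h => case5_not_troubled_of_reads_y₃ hf hd hF hC hS hcfg hφ' hI' αQ hBC hkC₃y (h ▸ hT)
        have hTC' : T' ≠ kC₃ := fun h => case5_not_troubled_of_reads_y₃ hf hd hF hC hS hcfg hφ' hI' αQ hBC hkC₃y (h ▸ hT')
        by_contra hTT'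
        have h3 := three_le_fanout ha ha' hkC₃u hTT' hTC hTC'
        have h2 := Troubled.fanout_eq_two hT ha
        omega
    · -- (3) no new troubled gate at all
      push Not at hrepl₃
      refine case5_main' hf hd hF hC hS hcfg hφ' hI' αQ fun T hT => ?_
      by_contra hnT
      obtain ⟨u, hIu, hr₂u, hnT₂, a, ha⟩ := hnew T hT hnT
      have hux : u ≠ x := fun h => hIx (by rw [hIu, h])
      have huy : u ≠ y := fun h => hIy (by rw [hIu, h])
      have hkBu : (case5E₂ hf hd hF hC hS hcfg hφ' hI' αQ).C'.arg (case5kB hf hd hF hC hS hcfg hφ' hI' αQ) aB.rev = .var u := by rw [hB₂rev, hr₂u]; rfl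
      -- the replacement node of `B` is `u`
      have hr₃ : (case5E₃ hf hd hF hC hS hcfg hφ' hI' αQ).repl = .var u := by
        rcases (case5E₃ hf hd hF hC hS hcfg hφ' hI' αQ).repl_cases with ⟨b, hb⟩ | ⟨a', ha'⟩
        · exact absurd hb (hrepl₃ b)
        · rcases fin2_eq_or_eq_rev aB a' with e | e
          · rw [e, hkBc] at ha'; exact absurd ha'.symm (hrepl₃ _)
          · rw [e, hkBu] at ha'; exact ha'.symm
      -- out-degree of `u`: `fanout₃(u) = fanout_C(u) + fanout_C(D) + fanout_C(B) - 2 = 2`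
      have hfu₃ := Troubled.fanout_eq_two hT ha
      have hcountD : (univ.filter fun a'' : Fin 2 => (case5E₁ hf hd hF hC hS hcfg hφ' hI' αQ).C'.arg (case5kD hf hd hF hC hS hcfg hφ' hI' αQ) a'' = .var u).card = 1 := by
        rw [card_eq_one]; refine ⟨aD.rev, ?_⟩; ext a''
        rw [mem_filter, mem_singleton]
        constructor
        · intro h
          rcases fin2_eq_or_eq_rev aD a'' with e' | e'
          · have := h.2; rw [e', hkDc] at this; cases this
          · exact e'
        · rintro rfl; refine ⟨mem_univ _, ?_⟩; rw [hkDrev, hIu]; rfl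
      have hcountB : (univ.filter fun a'' : Fin 2 => (case5E₂ hf hd hF hC hS hcfg hφ' hI' αQ).C'.arg (case5kB hf hd hF hC hS hcfg hφ' hI' αQ) a'' = .var u).card = 1 := by
        rw [card_eq_one]; refine ⟨aB.rev, ?_⟩; ext a''
        rw [mem_filter, mem_singleton]
        constructor
        · intro h
          rcases fin2_eq_or_eq_rev aB a'' with e' | e'
          · have := h.2; rw [e', hkBc] at this; cases this
          · exact e'
        · rintro rfl; exact ⟨mem_univ _, hkBu⟩
      have hfu₂ : (case5E₂ hf hd hF hC hS hcfg hφ' hI' αQ).C'.fanout (.var u) + 1 = C.fanout (.var u) + C.fanout (.gate D) := by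
        have h1 := (case5E₂ hf hd hF hC hS hcfg hφ' hI' αQ).fanout_repl_add
        rw [hr₂u, show (case5E₂ hf hd hF hC hS hcfg hφ' hI' αQ).pull (.var u) = .var u from rfl, hcountD, hfanu₁ hux huy, hfanD₁] at h1
        exact h1
      have hfu₃' : (case5E₃ hf hd hF hC hS hcfg hφ' hI' αQ).C'.fanout (.var u) + 1 = (case5E₂ hf hd hF hC hS hcfg hφ' hI' αQ).C'.fanout (.var u) + C.fanout (.gate B) := by
        have h1 := (case5E₃ hf hd hF hC hS hcfg hφ' hI' αQ).fanout_repl_add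
        rw [hr₃, show (case5E₃ hf hd hF hC hS hcfg hφ' hI' αQ).pull (.var u) = .var u from rfl, hcountB, hB2fan] at h1
        exact h1
      have hDu : 1 ≤ C.fanout (.var u) := one_le_fanout_of_arg_eq hIu
      have hD2 : 2 ≤ C.fanout (.gate D) := two_le_fanout hDB hDC hBC
      -- `B` is not the output (it would output the live variable `u`)
      have hB0 : C.fanout (.gate B) ≠ 0 := by
        intro hB0
        have hout₂ := hout_of_B (hN.out_of_fanout_eq_zero B hB0)
        exact out_ne_of_live_var hf hd₁ (case5E₂ hf hd hF hC hS hcfg hφ' hI' αQ).fair (case5E₂ hf hd hF hC hS hcfg hφ' hI' αQ).computes hkBc hkBu hout₂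
      have hCu : C.fanout (.var u) = 1 := by omega
      have hCD : C.fanout (.gate D) = 2 := by omega
      have hCB : C.fanout (.gate B) = 1 := by omega
      have hfu₂' : (case5E₂ hf hd hF hC hS hcfg hφ' hI' αQ).C'.fanout (.var u) = 2 := by omega
      -- where does `T` read `u` from?
      have hT₀and : IsAndOp (C.op ((case5E₁ hf hd hF hC hS hcfg hφ' hI' αQ).ι ((case5E₂ hf hd hF hC hS hcfg hφ' hI' αQ).ι ((case5E₃ hf hd hF hC hS hcfg hφ' hI' αQ).ι T)))) :=
        ((case5E₁ hf hd hF hC hS hcfg hφ' hI' αQ).isAndOp_iff _).mp (((case5E₂ hf hd hF hC hS hcfg hφ' hI' αQ).isAndOp_iff _).mp (((case5E₃ hf hd hF hC hS hcfg hφ' hI' αQ).isAndOp_iff T).mp hT.1))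
      obtain ⟨w, hw⟩ := Troubled.arg_isVar hT a.rev
      have hwu : w ≠ u := by
        intro h; rw [h] at hw
        exact Troubled.arg_ne hT a (by rw [ha, hw])
      rw [(case5E₃ hf hd hF hC hS hcfg hφ' hI' αQ).arg_eq_var_iff] at ha
      rcases ha with ha | ⟨haB, -⟩
      · -- `T₂` reads `u` directly: nothing changed for it
        have hw₂ : (case5E₂ hf hd hF hC hS hcfg hφ' hI' αQ).C'.arg ((case5E₃ hf hd hF hC hS hcfg hφ' hI' αQ).ι T) a.rev = .var w := by
          rw [(case5E₃ hf hd hF hC hS hcfg hφ' hI' αQ).arg_eq_var_iff] at hw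
          rcases hw with hw | ⟨-, hw⟩
          · exact hw
          · rw [hr₃] at hw; cases hw; exact absurd rfl hwu
        have h1 : ∀ a', (case5E₂ hf hd hF hC hS hcfg hφ' hI' αQ).C'.arg ((case5E₃ hf hd hF hC hS hcfg hφ' hI' αQ).ι T) a' ≠ .gate (case5kB hf hd hF hC hS hcfg hφ' hI' αQ) := by
          intro a' h
          rcases fin2_eq_or_eq_rev a a' with e | e
          · rw [e, ha] at h; cases h
          · rw [e, hw₂] at h; cases h
        have hiff := (case5E₃ hf hd hF hC hS hcfg hφ' hI' αQ).troubled_iff_of_fanouts h1 (fun a' i hi => ?_) ?_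
        · exact hnT₂ (hiff.mp hT)
        · -- the variables of `T₂` are `u` (out-degree preserved) and `w ≠ u` (untouched)
          rcases fin2_eq_or_eq_rev a a' with e | e
          · rw [e, ha] at hi; cases hi; omega
          · rw [e, hw₂] at hi; cases hi
            refine (case5E₃ hf hd hF hC hS hcfg hφ' hI' αQ).fanout_var_eq (fun a'' h => ?_) (by rw [hr₃]; exact fun h => hwu (Node.var.inj h).symm)
            rcases fin2_eq_or_eq_rev aB a'' with e' | e'
            · rw [e', hkBc] at h; cases h
            · rw [e', hkBu] at h; cases h; exact hwu rfl
        · refine (case5E₃ hf hd hF hC hS hcfg hφ' hI' αQ).fanout_gate_eq (fun a'' h => ?_) (by rw [hr₃]; exact fun h => by cases h)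
          rcases fin2_eq_or_eq_rev aB a'' with e' | e'
          · rw [e', hkBc] at h; cases h
          · rw [e', hkBu] at h; cases h
      · -- `T₂` reads `(case5kB hf hd hF hC hS hcfg hφ' hI' αQ)`: `T₀` is an ∧-gate reading `B` and the variable `w`: the alternative configuration
        rw [(case5E₂ hf hd hF hC hS hcfg hφ' hI' αQ).arg_eq_gate_iff, hkB] at haB
        rcases haB with haB | ⟨-, haB⟩
        swap; · rw [hr₂u] at haB; cases haB
        rw [(case5E₁ hf hd hF hC hS hcfg hφ' hI' αQ).arg_eq_gate_iff, hkB₁] at haB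
        rcases haB with haB | ⟨-, haB⟩
        swap; · rw [hrepl₁] at haB; cases haB
        have hT₀B := hC₁gate.mp haB
        -- the other wire `w` of `T` is a variable wire of `T₀`
        rw [(case5E₃ hf hd hF hC hS hcfg hφ' hI' αQ).arg_eq_var_iff] at hw
        rcases hw with hw | ⟨-, hw⟩
        swap; · rw [hr₃] at hw; cases hw; exact absurd rfl hwu
        rw [(case5E₂ hf hd hF hC hS hcfg hφ' hI' αQ).arg_eq_var_iff] at hw
        rcases hw with hw | ⟨-, hw⟩
        swap; · rw [hr₂u] at hw; cases hw; exact absurd rfl hwu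
        rw [(case5E₁ hf hd hF hC hS hcfg hφ' hI' αQ).arg_eq_var_iff] at hw
        rcases hw with hw | ⟨-, hw⟩
        swap; · rw [hrepl₁] at hw; cases hw
        have hT₀w := (hC₁var.mp hw).1
        exact hAlt _ a w hT₀and hT₀B hT₀w hCB



end Semicircuit

open Semicircuit in
/-- **Case 5.2 of the proof of Thm. 4.1.** [cite: LiYang2022, §4.1 (Case 5.2)] -/
theorem LiYang2022_case5_2_holds : LiYang2022_case5_2 := by
  intro αφ αI αQ hφ0 hφ hI hQ n d f hf C R hF hC hd hS G x y B C' D aX aB aC aD hcfg hextra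
  obtain ⟨hBC, ⟨aDB, hDB⟩, ⟨aDC, hDC⟩⟩ := hextra
  have haDB : aDB = aB.rev := by
    rcases fin2_eq_or_eq_rev aB aDB with e | e
    · rw [e, hcfg.arg_B] at hDB; cases hDB
    · exact e
  have haDC : aDC = aC.rev := by
    rcases fin2_eq_or_eq_rev aC aDC with e | e
    · rw [e, hcfg.arg_C] at hDC; cases hDC
    · exact e
  rw [haDB] at hDB; rw [haDC] at hDC
  exact LiYang2022_case5_2_holds_aux hf hd hF hC hS hcfg hφ0 hφ hI αQ hBC hDB hDC


end Literature.Computability.Complexity
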